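import Literature.Probability.Moments.BrascampLiebVarianceProofs
import Mathlib.Analysis.SpecialFunctions.JapaneseBracket
import HarnessLib

/-!
# Brascamp–Lieb 1976, Theorem 4.1 — the integrability clause

`Literature/Probability/Distributions/`. Proofs towards the named fact
`Literature.Probability.Distributions.BrascampLieb1976_thm41` (file `BrascampLieb`), following the
printed statement (H. J. Brascamp, E. H. Lieb, J. Funct. Anal. **22** (1976) 366–389, Thm 4.1,
p. 375): "Let `f` be twice continuously differentiable and let `f` be strictly convex. Let `f` have
a minimum, so that `F = exp[-f]` decreases exponentially in all directions; then `∫ F(x) dx < ∞`."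

This file proves exactly that first clause of the theorem, in the typing of the named fact:

* `strictConvexOn_of_posDef_coordHessian` — `f ∈ C²` with positive definite coordinate Hessian
  `f_xx` is strictly convex (second-derivative test along lines);
* `integrable_exp_neg_mul_norm_sub` — `x ↦ e^{-c‖x - x₀‖}` (`c > 0`) is integrable for an
  additive Haar measure on a finite-dimensional real normed space (domination by
  `(1 + ‖x‖)^{-r}`, `r > dim`, `Mathlib`'s `integrable_one_add_norm`);
* `lintegral_exp_neg_lt_top_of_posDef_coordHessian` — "`F` decreases exponentially in all
  directions, hence `∫ F < ∞`": a strictly convex function with a minimum at `x₀` grows at least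
  like `c‖x - x₀‖` outside the unit ball (`c` = the minimum of `f - f(x₀)` on the unit sphere,
  positive by strict convexity), so `e^{-f} ≤ e^{c - f(x₀)} e^{-c‖x - x₀‖}`.

The second clause of Theorem 4.1 (the variance inequality (4.5) itself, printed proof pp. 377–379:
one-dimensional integration by parts, induction on the dimension through Theorem 4.2, removal of
the compact-support restriction by two limiting procedures) is NOT proved here; the named fact
stays undischarged. No definitions, no new named facts.
-/

noncomputable section

open MeasureTheory ProbabilityTheory Filter Set WithLp Module
open scoped ENNReal NNReal Topology Matrix RealInnerProductSpace

namespace Literature.Probability.Distributions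

open Literature.Probability.Moments (coordHessian_apply_eq bilin_apply_eq_sum_single)

variable {n : ℕ}

/-- The quadratic form of the coordinate Hessian is the second Fréchet derivative on the
diagonal: `wᵀ f_xx(x) w = D²f(x)(w)(w)`. [folklore] -/
theorem dotProduct_coordHessian_mulVec {F : (Fin n → ℝ) → ℝ} {x : Fin n → ℝ}
    (hF : DifferentiableAt ℝ (fderiv ℝ F) x) (w : Fin n → ℝ) :
    w ⬝ᵥ (coordHessian F x *ᵥ w) = fderiv ℝ (fderiv ℝ F) x w w := by
  rw [bilin_apply_eq_sum_single (fderiv ℝ (fderiv ℝ F) x) w w]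
  simp only [dotProduct, Matrix.mulVec, coordHessian_apply_eq hF]

/-- Second derivative of a `C²` function along a line:
`d/ds Df(x + s v)(v) = D²f(x + t v)(v)(v)` at `s = t`. [folklore] -/
theorem hasDerivAt_fderiv_line {F : (Fin n → ℝ) → ℝ} (hF : ContDiff ℝ 2 F)
    (x v : Fin n → ℝ) (t : ℝ) :
    HasDerivAt (fun s : ℝ => fderiv ℝ F (x + s • v) v)
      (fderiv ℝ (fderiv ℝ F) (x + t • v) v v) t := by
  have hdiff : Differentiable ℝ (fderiv ℝ F) :=
    (hF.fderiv_right (m := 1) (by norm_num)).differentiable (by norm_num)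
  have hl : HasDerivAt (fun s : ℝ => x + s • v) v t := by
    simpa using ((hasDerivAt_id t).smul_const v).const_add x
  have hG : HasFDerivAt (fderiv ℝ F) (fderiv ℝ (fderiv ℝ F) (x + t • v)) (x + t • v) :=
    (hdiff _).hasFDerivAt
  have hG' : HasDerivAt (fun s : ℝ => fderiv ℝ F (x + s • v))
      (fderiv ℝ (fderiv ℝ F) (x + t • v) v) t := hG.comp_hasDerivAt t hl
  have := hG'.clm_apply (hasDerivAt_const t v)
  simpa using this

/-- First derivative of a differentiable function along a line:
`d/ds f(x + s v) = Df(x + t v)(v)` at `s = t`. [folklore] -/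
theorem hasDerivAt_line {F : (Fin n → ℝ) → ℝ} (hF : Differentiable ℝ F)
    (x v : Fin n → ℝ) (t : ℝ) :
    HasDerivAt (fun s : ℝ => F (x + s • v)) (fderiv ℝ F (x + t • v) v) t := by
  have hl : HasDerivAt (fun s : ℝ => x + s • v) v t := by
    simpa using ((hasDerivAt_id t).smul_const v).const_add x
  exact (hF _).hasFDerivAt.comp_hasDerivAt t hl

/-- **Second-derivative test.** A `C²` function on `ℝⁿ` whose coordinate Hessian is positive
definite everywhere is strictly convex (the reading of "strictly convex" in Brascamp–Lieb, p. 375: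
restrict to the line through `x ≠ y`, where `g″ > 0`). [folklore] -/
theorem strictConvexOn_of_posDef_coordHessian {F : (Fin n → ℝ) → ℝ} (hF : ContDiff ℝ 2 F)
    (hpos : ∀ x, (coordHessian F x).PosDef) : StrictConvexOn ℝ univ F := by
  have hdiffF : Differentiable ℝ F := hF.differentiable (by norm_num)
  have hdiff : Differentiable ℝ (fderiv ℝ F) :=
    (hF.fderiv_right (m := 1) (by norm_num)).differentiable (by norm_num)
  have hD2 : ∀ x w, w ≠ 0 → 0 < fderiv ℝ (fderiv ℝ F) x w w := by
    intro x w hw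
    have h := (hpos x).dotProduct_mulVec_pos hw
    rwa [star_trivial, dotProduct_coordHessian_mulVec (hdiff x)] at h
  refine ⟨convex_univ, ?_⟩
  intro x _ y _ hxy a b ha hb hab
  -- restrict to the line through `x` and `y`
  set v : Fin n → ℝ := y - x with hv
  have hv0 : v ≠ 0 := sub_ne_zero.mpr (Ne.symm hxy)
  set g : ℝ → ℝ := fun s => F (x + s • v) with hg
  have hg1 : ∀ s, HasDerivAt g (fderiv ℝ F (x + s • v) v) s := fun s => hasDerivAt_line hdiffF x v s
  have hg2 : ∀ s, HasDerivAt (fun s : ℝ => fderiv ℝ F (x + s • v) v)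
      (fderiv ℝ (fderiv ℝ F) (x + s • v) v v) s := fun s => hasDerivAt_fderiv_line hF x v s
  have hderiv_g : deriv g = fun s => fderiv ℝ F (x + s • v) v := funext fun s => (hg1 s).deriv
  have hderiv2_g : ∀ s, deriv^[2] g s = fderiv ℝ (fderiv ℝ F) (x + s • v) v v := by
    intro s
    show deriv (deriv g) s = _
    rw [hderiv_g]
    exact (hg2 s).deriv
  have hgconv : StrictConvexOn ℝ univ g :=
    strictConvexOn_univ_of_deriv2_pos (by
      have : g = F ∘ fun s : ℝ => x + s • v := rfl
      rw [this]
      exact hF.continuous.comp (by fun_prop))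
      fun s => by rw [hderiv2_g]; exact hD2 _ _ hv0
  have h01 : (0 : ℝ) ≠ 1 := zero_ne_one
  have key := hgconv.2 (mem_univ 0) (mem_univ 1) h01 ha hb hab
  -- translate back
  have e1 : a • x + b • y = x + (a • (0 : ℝ) + b • 1) • v := by
    rw [hv, smul_zero, zero_add, smul_eq_mul, mul_one]
    have : a = 1 - b := by linarith
    rw [this]
    simp only [sub_smul, one_smul, smul_sub]
    abel
  have e2 : g 0 = F x := by simp [hg]
  have e3 : g 1 = F y := by simp [hg, hv]
  rw [e1]
  calc F (x + (a • (0 : ℝ) + b • 1) • v) = g (a • 0 + b • 1) := rfl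
    _ < a • g 0 + b • g 1 := key
    _ = a • F x + b • F y := by rw [e2, e3]

/-- Exponential decay is integrable: `x ↦ exp (-c‖x - x₀‖)` (`c > 0`) is integrable on a
finite-dimensional real normed space with an additive Haar measure (domination
`e^{-ct} ≤ r! e^{c} c^{-r} (1 + t)^{-r}` with `r = dim + 1`). [folklore] -/
theorem integrable_exp_neg_mul_norm_sub {E : Type*} [NormedAddCommGroup E] [NormedSpace ℝ E]
    [FiniteDimensional ℝ E] [MeasurableSpace E] [BorelSpace E] (μ : Measure E) [μ.IsAddHaarMeasure]
    {c : ℝ} (hc : 0 < c) (x₀ : E) :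
    Integrable (fun x => Real.exp (-(c * ‖x - x₀‖))) μ := by
  -- domination `exp(-c t) ≤ C (1 + t)^{-r}` with `r = finrank + 1`
  set r : ℕ := finrank ℝ E + 1 with hr
  have hnr : (finrank ℝ E : ℝ) < (r : ℝ) := by
    rw [hr]; push_cast; linarith
  set C : ℝ := (r.factorial : ℝ) * Real.exp c / c ^ r with hC
  have hbound : ∀ t : ℝ, 0 ≤ t → Real.exp (-(c * t)) ≤ C * (1 + t) ^ (-(r : ℝ)) := by
    intro t ht
    have h1t : 0 < 1 + t := by linarith
    have hct : 0 ≤ c * (1 + t) := by positivity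
    have hpow := Real.pow_div_factorial_le_exp _ hct r
    -- `(c(1+t))^r / r! ≤ exp (c(1+t))`
    rw [Real.rpow_neg h1t.le, Real.rpow_natCast, hC]
    rw [div_le_iff₀ (by positivity)] at hpow
    have hfac : (0 : ℝ) < r.factorial := by exact_mod_cast r.factorial_pos
    have hcr : 0 < c ^ r := pow_pos hc r
    have h1tr : 0 < (1 + t) ^ r := pow_pos h1t r
    -- goal: exp(-(c t)) ≤ r! e^c / c^r * ((1+t)^r)⁻¹
    rw [show (r.factorial : ℝ) * Real.exp c / c ^ r * ((1 + t) ^ r)⁻¹ =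
        (r.factorial : ℝ) * Real.exp c / (c ^ r * (1 + t) ^ r) by
      field_simp]
    rw [le_div_iff₀ (by positivity)]
    have : c ^ r * (1 + t) ^ r = (c * (1 + t)) ^ r := by rw [mul_pow]
    rw [this]
    calc Real.exp (-(c * t)) * (c * (1 + t)) ^ r
        ≤ Real.exp (-(c * t)) * (Real.exp (c * (1 + t)) * r.factorial) :=
          mul_le_mul_of_nonneg_left hpow (Real.exp_pos _).le
      _ = r.factorial * Real.exp c := by
          rw [← mul_assoc, ← Real.exp_add]
          ring_nf
  have hint : Integrable (fun x : E => C * (1 + ‖x - x₀‖) ^ (-(r : ℝ))) μ := by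
    have h0 := (integrable_one_add_norm (μ := μ) hnr).const_mul C
    exact h0.comp_sub_right x₀
  refine hint.mono' (by fun_prop) (ae_of_all _ fun x => ?_)
  rw [Real.norm_eq_abs, abs_of_pos (Real.exp_pos _)]
  exact hbound _ (norm_nonneg _)

/-- **Brascamp–Lieb 1976, Theorem 4.1, first clause**: "let `f ∈ C²` be strictly convex
[`f_xx > 0`] and have a minimum, so that `F = e^{-f}` decreases exponentially in all directions;
then `∫ F dx < ∞`" — here as `∫⁻ e^{-f} < ∞` for Lebesgue measure on `Fin n → ℝ`, exactly the
first conjunct of `BrascampLieb1976_thm41`. Proof: with `x₀` the minimiser and `c > 0` the minimum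
of `f - f(x₀)` on the unit sphere, convexity along rays gives `f(x) - f(x₀) ≥ c‖x - x₀‖` for
`‖x - x₀‖ ≥ 1`. [cite: BrascampLieb1976, Thm 4.1] -/
theorem lintegral_exp_neg_lt_top_of_posDef_coordHessian {f : (Fin n → ℝ) → ℝ}
    (hf : ContDiff ℝ 2 f) (hpos : ∀ x, (coordHessian f x).PosDef)
    (hmin : ∃ x₀, ∀ x, f x₀ ≤ f x) :
    (∫⁻ x, ENNReal.ofReal (Real.exp (-f x))) < ∞ := by
  obtain ⟨x₀, hx₀⟩ := hmin
  rcases isEmpty_or_nonempty (Fin n) with hn | hn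
  · -- dimension zero: the space is a point
    have hsub : Subsingleton (Fin n → ℝ) := inferInstance
    have hconst : (fun x : Fin n → ℝ => ENNReal.ofReal (Real.exp (-f x))) =
        fun _ => ENNReal.ofReal (Real.exp (-f x₀)) := by
      funext x; rw [Subsingleton.elim x x₀]
    rw [hconst, lintegral_const, volume_pi, Measure.pi_of_empty (x := x₀)]
    simp
  -- positive dimension
  have hconv := strictConvexOn_of_posDef_coordHessian hf hpos
  have hcont : Continuous f := hf.continuous
  -- minimum of `f - f x₀` on the unit sphere around `x₀`
  obtain ⟨ys, hys, hymin⟩ := (isCompact_sphere x₀ (1 : ℝ)).exists_isMinOn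
    ((NormedSpace.sphere_nonempty (E := Fin n → ℝ)).mpr zero_le_one) hcont.continuousOn
  set c : ℝ := f ys - f x₀ with hc
  have hys_ne : ys ≠ x₀ := by
    intro h
    rw [Metric.mem_sphere, h, dist_self] at hys
    exact zero_ne_one hys
  have hcpos : 0 < c := by
    rw [hc, sub_pos]
    by_contra hle
    have hle : f ys ≤ f x₀ := not_lt.mp hle
    -- midpoint is strictly below the minimum
    have hmid := hconv.2 (mem_univ ys) (mem_univ x₀) hys_ne (by norm_num : (0 : ℝ) < 1 / 2)
      (by norm_num : (0 : ℝ) < 1 / 2) (by norm_num : (1 / 2 : ℝ) + 1 / 2 = 1)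
    have := hx₀ ((1 / 2 : ℝ) • ys + (1 / 2 : ℝ) • x₀)
    have h2 : (1 / 2 : ℝ) • f ys + (1 / 2 : ℝ) • f x₀ ≤ f x₀ := by
      rw [smul_eq_mul, smul_eq_mul]; linarith
    linarith
  -- linear growth outside the unit ball
  have hgrowth : ∀ x, 1 ≤ ‖x - x₀‖ → c * ‖x - x₀‖ ≤ f x - f x₀ := by
    intro x hx
    set ρ : ℝ := ‖x - x₀‖ with hρ
    have hρpos : 0 < ρ := lt_of_lt_of_le zero_lt_one hx
    set u : Fin n → ℝ := x₀ + ρ⁻¹ • (x - x₀) with hu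
    have hu_sphere : u ∈ Metric.sphere x₀ 1 := by
      rw [mem_sphere_iff_norm, hu, add_sub_cancel_left, norm_smul, norm_inv, Real.norm_eq_abs,
        abs_of_pos hρpos, inv_mul_cancel₀ hρpos.ne']
    have hfu : f ys ≤ f u := hymin hu_sphere
    -- `u = (1 - ρ⁻¹) • x₀ + ρ⁻¹ • x`
    have hu' : u = (1 - ρ⁻¹) • x₀ + ρ⁻¹ • x := by
      rw [hu, smul_sub, sub_smul, one_smul]; abel
    have hρinv : ρ⁻¹ ≤ 1 := inv_le_one_of_one_le₀ hx
    have hcvx := hconv.convexOn.2 (mem_univ x₀) (mem_univ x) (by linarith : (0 : ℝ) ≤ 1 - ρ⁻¹)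
      (by positivity : (0 : ℝ) ≤ ρ⁻¹) (by ring : (1 - ρ⁻¹) + ρ⁻¹ = 1)
    rw [← hu', smul_eq_mul, smul_eq_mul] at hcvx
    -- `f u ≤ (1-ρ⁻¹) f x₀ + ρ⁻¹ f x`  ⇒  `ρ (f u - f x₀) ≤ f x - f x₀`
    have h1 : f u - f x₀ ≤ ρ⁻¹ * (f x - f x₀) := by linarith
    have h2 : ρ * (f u - f x₀) ≤ f x - f x₀ := by
      have := mul_le_mul_of_nonneg_left h1 hρpos.le
      rwa [← mul_assoc, mul_inv_cancel₀ hρpos.ne', one_mul] at this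
    calc c * ρ ≤ (f u - f x₀) * ρ := by
          apply mul_le_mul_of_nonneg_right _ hρpos.le
          rw [hc]; linarith
      _ = ρ * (f u - f x₀) := by ring
      _ ≤ f x - f x₀ := h2
  -- pointwise domination by an integrable exponential
  have hdom : ∀ x, Real.exp (-f x) ≤ Real.exp (c - f x₀) * Real.exp (-(c * ‖x - x₀‖)) := by
    intro x
    rw [← Real.exp_add]
    apply Real.exp_le_exp.mpr
    by_cases hx : 1 ≤ ‖x - x₀‖
    · have := hgrowth x hx
      linarith
    · have hx : ‖x - x₀‖ < 1 := not_le.mp hx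
      have h1 := hx₀ x
      have h2 : c * ‖x - x₀‖ ≤ c := by
        calc c * ‖x - x₀‖ ≤ c * 1 := mul_le_mul_of_nonneg_left hx.le hcpos.le
          _ = c := mul_one c
      linarith
  have hint : Integrable (fun x : Fin n → ℝ => Real.exp (-f x)) := by
    have hI := (integrable_exp_neg_mul_norm_sub (volume : Measure (Fin n → ℝ)) hcpos x₀).const_mul
      (Real.exp (c - f x₀))
    refine hI.mono' (by fun_prop) (ae_of_all _ fun x => ?_)
    rw [Real.norm_eq_abs, abs_of_pos (Real.exp_pos _)]
    exact hdom x
  exact hint.lintegral_lt_top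

end Literature.Probability.Distributions

end
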